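import Mathlib
import Summits.QuantumAdvantage.QuantumAdvantage.Theorems.MobiusLadderDigitPolyUniformityDefs
import Summits.QuantumAdvantage.QuantumAdvantage.Theorems.MobiusLadderDigitPolyUniformityLARShiftMapMem
import Summits.QuantumAdvantage.QuantumAdvantage.Theorems.MobiusLadderDigitPolyUniformityLARValSucc
import Summits.QuantumAdvantage.QuantumAdvantage.Theorems.MobiusLadderDigitPolyUniformityLARShiftFinrank
import Summits.QuantumAdvantage.QuantumAdvantage.Theorems.MobiusLadderDigitPolyUniformityLARAnnRankDualityCore
import Literature.Computability.MetaComplexity.SmolenskyDimensionBound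
import Literature.Computability.MetaComplexity.TruthTables

/-!
# `DigitPolyUniformity` (stmt-QuantumAdvantage-1392), line `Sketch`/LAR — the SHIFT inequality

Companion of the LAR skeleton (`Cruxes/DigitPolyUniformity/Lines/SketchLAR.lean`, v4). Multiplicativity of
`λ` enters the annihilator-rank world in its simplest instance, the carry-free dilation by `2`:
`val(0, b′) = 2·val(b′)` (`stub_val_succ`, p117720) and `λ(2m) = −λ(m)`, so an annihilator `g` of
`{λ(val) ≠ −1}` of degree `≤ k` on `n` bits yields `h(b) = [b₀ = 0]·g(b₁,…,b_n)`, an annihilator of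
`{λ(val) = −1}` of degree `≤ k + 1` on `n + 1` bits (`stub_shiftMap_mem`, p117608), injectively
(`stub_shift_finrank`, p117699):

  `annRank_k((liouSet n)ᶜ) ≤ annRank_{k+1}(liouSet (n+1))`            (`annRank_compl_le_shift`).

Consequence (`lar_two_sets_of_one`): the two-set transferred crux (v2: below capacity, both `liouSet n` and
its complement have annihilator rank `≤ ε2ⁿ`) follows from its `liouSet` clause alone — the registered
transferred crux `stub_LAR` v4 is ONE set, ONE clause.
-/

noncomputable section

namespace Summit.QuantumAdvantage.DigitPolyUniformity.SketchLAR

open Filter Finset Module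
open Literature.Computability.MetaComplexity (boolFunEquivFin)
open Literature.Computability.MetaComplexity.Smolensky (CubeFn mono lowDeg)

/-! ### The shift inequality in `annRank` form -/

/-- `vanishOn (liouSet n)` as the kernel of the restriction to the Liouville digit set. [folklore] -/
theorem vanishOn_liouSet_eq_ker (n : ℕ) :
    vanishOn (ZMod 2) (liouSet n) =
      LinearMap.ker (LinearMap.funLeft (ZMod 2) (ZMod 2) (Subtype.val :
        {b : Fin n → Bool // ArithmeticFunction.liouville ((boolFunEquivFin n b : Fin (2 ^ n)) : ℕ) = -1} →
          (Fin n → Bool))) := by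
  ext h
  rw [mem_vanishOn, AnnRankDualityCore.mem_ker_funLeft_iff]
  rfl

/-- `vanishOn (liouSet n)ᶜ` as the kernel of the restriction to the complement. [folklore] -/
theorem vanishOn_liouSet_compl_eq_ker (n : ℕ) :
    vanishOn (ZMod 2) (liouSet n)ᶜ =
      LinearMap.ker (LinearMap.funLeft (ZMod 2) (ZMod 2) (Subtype.val :
        {b : Fin n → Bool // ArithmeticFunction.liouville ((boolFunEquivFin n b : Fin (2 ^ n)) : ℕ) ≠ -1} →
          (Fin n → Bool))) := by
  ext h
  rw [mem_vanishOn, AnnRankDualityCore.mem_ker_funLeft_iff]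
  rfl

/-- **The shift inequality**: `annRank_k((liouSet n)ᶜ) ≤ annRank_{k+1}(liouSet (n+1))` — annihilators of
`{λ = +1} ∪ {0}` in degree `≤ k` become, through `g ↦ [b₀ = 0]·g(b₁…b_n)` and `λ(2m) = −λ(m)`,
annihilators of `{λ = −1}` one bit up, in degree `≤ k + 1`. [folklore] -/
theorem annRank_compl_le_shift (n k : ℕ) :
    annRank (ZMod 2) n k (liouSet n)ᶜ ≤ annRank (ZMod 2) (n + 1) (k + 1) (liouSet (n + 1)) := by
  rw [annRank_eq, annRank_eq, vanishOn_liouSet_compl_eq_ker, vanishOn_liouSet_eq_ker]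
  exact stub_shift_finrank (fun g hg => stub_shiftMap_mem g hg) (fun b => stub_val_succ b)

/-! ### One set, one clause suffices -/

/-- Level bookkeeping for the shift: eventually `⌈(ε/2)√(n+1)⌉ + 1 ≤ ⌈ε√n⌉`. [folklore] -/
theorem eventually_ceil_shift {ε : ℝ} (hε : 0 < ε) :
    ∀ᶠ n : ℕ in atTop, ⌈ε / 2 * Real.sqrt (((n + 1 : ℕ) : ℝ))⌉₊ + 1 ≤ ⌈ε * Real.sqrt n⌉₊ := by
  have hsqrt : Tendsto (fun n : ℕ => Real.sqrt n) atTop atTop :=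
    Real.tendsto_sqrt_atTop.comp tendsto_natCast_atTop_atTop
  filter_upwards [hsqrt.eventually_ge_atTop (1 + 4 / ε)] with n hn
  have hs1 : Real.sqrt (((n + 1 : ℕ) : ℝ)) ≤ Real.sqrt n + 1 := by
    rw [Real.sqrt_le_left (by positivity)]
    push_cast
    nlinarith [Real.sq_sqrt (Nat.cast_nonneg n), Real.sqrt_nonneg (n : ℝ)]
  have hc : (⌈ε / 2 * Real.sqrt (((n + 1 : ℕ) : ℝ))⌉₊ : ℝ) < ε / 2 * Real.sqrt (((n + 1 : ℕ) : ℝ)) + 1 :=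
    Nat.ceil_lt_add_one (by positivity)
  have hle : ε * Real.sqrt n ≤ (⌈ε * Real.sqrt n⌉₊ : ℝ) := Nat.le_ceil _
  have hkey : ε / 2 * Real.sqrt (((n + 1 : ℕ) : ℝ)) + 2 ≤ ε * Real.sqrt n := by
    have h1 : ε / 2 * Real.sqrt (((n + 1 : ℕ) : ℝ)) ≤ ε / 2 * (Real.sqrt n + 1) :=
      mul_le_mul_of_nonneg_left hs1 (by positivity)
    have h2 : ε / 2 * (1 + 4 / ε) ≤ ε / 2 * Real.sqrt n := mul_le_mul_of_nonneg_left hn (by positivity)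
    have h3 : ε / 2 * (1 + 4 / ε) = ε / 2 + 2 := by field_simp; ring
    nlinarith
  have hfin : (⌈ε / 2 * Real.sqrt (((n + 1 : ℕ) : ℝ))⌉₊ : ℝ) + 1 < (⌈ε * Real.sqrt n⌉₊ : ℝ) := by
    linarith
  have hnat : ⌈ε / 2 * Real.sqrt (((n + 1 : ℕ) : ℝ))⌉₊ + 1 < ⌈ε * Real.sqrt n⌉₊ := by
    exact_mod_cast hfin
  exact hnat.le

/-- **One set, one clause ⇒ two sets** (via the shift inequality): if below capacity the Liouville digit set
has annihilator rank `≤ ε2ⁿ` (for every `ε`, eventually), then so does its complement. [folklore] -/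
theorem lar_two_sets_of_one
    (h : ∀ ε : ℝ, 0 < ε → ∀ᶠ n : ℕ in atTop, ∀ k : ℕ, k + ⌈ε * Real.sqrt n⌉₊ ≤ n / 2 →
      (annRank (ZMod 2) n k (liouSet n) : ℝ) ≤ ε * 2 ^ n) :
    ∀ ε : ℝ, 0 < ε → ∀ᶠ n : ℕ in atTop, ∀ k : ℕ, k + ⌈ε * Real.sqrt n⌉₊ ≤ n / 2 →
      (annRank (ZMod 2) n k (liouSet n) : ℝ) ≤ ε * 2 ^ n ∧
        (annRank (ZMod 2) n k (liouSet n)ᶜ : ℝ) ≤ ε * 2 ^ n := by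
  intro ε hε
  have h1 := h ε hε
  have h2 : ∀ᶠ n : ℕ in atTop, ∀ k : ℕ, k + ⌈ε / 2 * Real.sqrt (((n + 1 : ℕ) : ℝ))⌉₊ ≤ (n + 1) / 2 →
      (annRank (ZMod 2) (n + 1) k (liouSet (n + 1)) : ℝ) ≤ ε / 2 * 2 ^ (n + 1) :=
    (tendsto_add_atTop_nat 1).eventually (h (ε / 2) (by positivity))
  filter_upwards [h1, h2, eventually_ceil_shift hε] with n hn1 hn2 hn3
  intro k hk
  refine ⟨hn1 k hk, ?_⟩
  have hlevel : k + 1 + ⌈ε / 2 * Real.sqrt (((n + 1 : ℕ) : ℝ))⌉₊ ≤ (n + 1) / 2 := by omega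
  have hshift := annRank_compl_le_shift n k
  have hcast : (annRank (ZMod 2) n k (liouSet n)ᶜ : ℝ) ≤
      (annRank (ZMod 2) (n + 1) (k + 1) (liouSet (n + 1)) : ℝ) := by exact_mod_cast hshift
  have h3 := hn2 (k + 1) hlevel
  have h4 : ε / 2 * (2 : ℝ) ^ (n + 1) = ε * 2 ^ n := by rw [pow_succ]; ring
  linarith

end Summit.QuantumAdvantage.DigitPolyUniformity.SketchLAR

end
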